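import Summits.KontsevichZagierPeriods.KontsevichZagierPeriods.Theorems.LinRedNormalFormArrangementNormalFormStubRebaseSimplePosOneFibreResidualSub
import Summits.KontsevichZagierPeriods.KontsevichZagierPeriods.Theorems.LinRedNormalFormArrangementNormalFormStubRebaseSimplePosOneFibreSwap

/-!
# Stub `stub_rebaseSimplePosOne` (crux `ArrangementNormalForm`, line `janus-bands`, v6.2) —
part `SwapSheared`: a transverse cell of the swapped band, after the shear of its letter

A cell of the swapped band (parts `Swap`, `OrderGood`) whose two bounds are the transverse
players is, after the shear of its `Y`-free letter `ℓ₂(x')` to `0` (rule 2), a band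
`{rows, a < T < b}` with letter `0`, transverse non-parallel bounds `a`, `b` and base factor
`g(x')/Y` (exponents `n₁ = 0`, `n₂ = 1`, base letter `0`), carrying a REGION INVARIANT inherited
from the pre-cut of the original base cell: two `x'`-forms `κ₀`, `φ₀` with `|κ₀| < |φ₀|` on the
domain, such that at every point where `|κ₀| ≤ |φ₀|` and `a = b = 0` the coordinate `Y`
vanishes (`hkey`; part `SwapBand` derives it from the geometry of the swap: `a = b = 0` forces
`φ₀ = 0`, the apex of the original band over the pole, and `Y = κ₀ + A φ₀`).
`RebasePos.good_shearedPiece`: such a band is congruent to the subgroup generated by `GG B 2 1`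
as soon as parallel bands (`Hpar`) and DOUBLE-CORNER bands — corner `κ = u = v = 0` in the
closure of the open base cell lying ON the pole hyperplane `Y = 0` — are (`Hdthick`, `Hdfar`):
cut for non-empty fibres and by the signs of `a`, `b` (rule 1a); above the letter
`RebasePos.good_above_of_corner₂` (every corner of a sub-cell satisfies `|κ₀| ≤ |φ₀|` on the
closure, hence is double by `hkey`); crossing: level split at `0`; below: reflection `T ↦ −T`
(rule 2) and the same. Registered: `rebaseSimplePos_absLeOfClosure`.

References: M. Kontsevich, D. Zagier, *Periods* (2001), §1.2, rules (1a), (2).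
-/

noncomputable section

open Set MeasureTheory MvPolynomial
open Literature.NumberTheory.Transcendental Literature.ModelTheory.ExponentialFields

namespace Summit.KontsevichZagierPeriods.ArrangementNormalForm.JanusBands

namespace RebasePos

open SeparatePos

section SwapSheared

variable {B m m' : ℕ}

/-- `x'`-affine forms are continuous. -/
theorem continuous_affB (d : (Fin B → ℚ) × ℚ) :
    Continuous fun z : Fin (B + 1 + 1) → ℝ => affB B 1 d z := by
  unfold affB
  fun_prop

/-- `affB` is unchanged by updating the fibre coordinate. -/
@[simp] theorem affB_update_tI (d : (Fin B → ℚ) × ℚ) (z : Fin (B + 1 + 1) → ℝ) (x : ℝ) :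
    affB B 1 d (Function.update z (tI B) x) = affB B 1 d z := by
  simp only [affB]
  refine congrArg (fun s => s + _) (Finset.sum_congr rfl fun i _ => ?_)
  rw [Function.update_of_ne (castAdd_ne_tI (Fin.castSucc i))]

/-- **The region invariant on the closed base cell.** If `|κ₀| < |φ₀|` on a set containing the
band `{rows, a < t < b}` with non-empty fibres over its base cell, then `|κ₀| ≤ |φ₀|` on the
closure of the open base cell. -/
theorem abs_le_of_closure (M : Fin m' → (Fin (B + 1) → ℚ) × ℚ) (a b : (Fin (B + 1) → ℚ) × ℚ)
    (κ₀ φ₀ : (Fin B → ℚ) × ℚ) {D : Set (Fin (B + 1 + 1) → ℝ)}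
    (hZ : ∀ w ∈ D, |affB B 1 κ₀ w| < |affB B 1 φ₀ w|)
    (hsub : gDom B 1 m' M (fun _ => Sum.inr a) (fun _ => Sum.inr b) ⊆ D)
    (hab : ∀ z : Fin (B + 1 + 1) → ℝ, (∀ j, 0 < affF B 1 (M j) z) → affF B 1 a z < affF B 1 b z) :
    ∀ z ∈ closure {z : Fin (B + 1 + 1) → ℝ | ∀ j, 0 < affF B 1 (M j) z},
      |affB B 1 κ₀ z| ≤ |affB B 1 φ₀ z| := by
  refine le_of_closure_rows ((continuous_affB κ₀).abs) ((continuous_affB φ₀).abs) fun z hz => ?_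
  set w : Fin (B + 1 + 1) → ℝ := Function.update z (tI B) ((affF B 1 a z + affF B 1 b z) / 2) with hw
  have hwD : w ∈ gDom B 1 m' M (fun _ => Sum.inr a) (fun _ => Sum.inr b) := by
    rw [mem_gDom_one]
    have hlt := hab z hz
    refine ⟨fun j => by rw [hw, affF_update_tI]; exact hz j, ?_, ?_⟩ <;>
      rw [hw, affF_update_tI, show Fin.natAdd (B + 1) 0 = tI B from rfl, Function.update_self] <;>
      linarith
  have h := hZ w (hsub hwD)
  rw [hw, affB_update_tI, affB_update_tI] at h
  exact h.le

variable (L : Fin m → (Fin B → ℚ) × ℚ) (e : Fin m → ℕ) (ℓ₁ : (Fin B → ℚ) × ℚ)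

/-- **A transverse cell of the swapped band after the shear of its letter.** See the module
docstring: band `{rows, a < T < b}` (letter `0`, transverse non-parallel bounds, base factor
`g(x')/Y`) with the region invariant `|κ₀| < |φ₀|` and the key property `hkey`; good from
parallel bands and double-corner bands. -/
theorem good_shearedPiece (s : KZ.IntegralRep (B + 1 + 1)) (M : Fin m' → (Fin (B + 1) → ℚ) × ℚ)
    (p : MvPolynomial (Fin B) ℚ) (a b : (Fin (B + 1) → ℚ) × ℚ) (κ₀ φ₀ : (Fin B → ℚ) × ℚ)
    (hbd : Bornology.IsBounded s.domain)
    (hdom : s.domain = gDom B 1 m' M (fun _ => Sum.inr a) (fun _ => Sum.inr b))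
    (hint : EqOn s.integrand (glit B 1 p L e ℓ₁ 0 0 1 (fun _ => some 0)) s.domain)
    (ha : a.1 (Fin.last B) ≠ 0) (hb : b.1 (Fin.last B) ≠ 0) (hab : a.1 (Fin.last B) ≠ b.1 (Fin.last B))
    (hZ : ∀ w ∈ s.domain, |affB B 1 κ₀ w| < |affB B 1 φ₀ w|)
    (hkey : ∀ z : Fin (B + 1 + 1) → ℝ, |affB B 1 κ₀ z| ≤ |affB B 1 φ₀ z| →
      affF B 1 a z = 0 → affF B 1 b z = 0 → z (Fin.castAdd 1 (Fin.last B)) = 0)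
    (Hpar : ∀ (m' : ℕ) (s : KZ.IntegralRep (B + 1 + 1)) (M : Fin m' → (Fin (B + 1) → ℚ) × ℚ)
      (p : MvPolynomial (Fin B) ℚ) (u v : (Fin (B + 1) → ℚ) × ℚ), Bornology.IsBounded s.domain →
      s.domain = gDom B 1 m' M (fun _ => Sum.inr u) (fun _ => Sum.inr v) →
      EqOn s.integrand (glit B 1 p L e ℓ₁ 0 0 1 (fun _ => some 0)) s.domain →
      u.1 (Fin.last B) ≠ 0 → u.1 (Fin.last B) = v.1 (Fin.last B) →
      (∀ z : Fin (B + 1 + 1) → ℝ, (∀ j, 0 < affF B 1 (M j) z) → 0 < affF B 1 u z ∧ affF B 1 u z < affF B 1 v z) →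
      ∃ c ∈ AddSubgroup.closure (GGset B 2 1), KZ.of s - c ∈ KZ.relations)
    (Hdthick : ∀ (m' : ℕ) (s : KZ.IntegralRep (B + 1 + 1)) (M : Fin m' → (Fin (B + 1) → ℚ) × ℚ)
      (p : MvPolynomial (Fin B) ℚ) (u v κ : (Fin (B + 1) → ℚ) × ℚ) (A : ℚ), Bornology.IsBounded s.domain →
      s.domain = gDom B 1 m' M (fun _ => Sum.inr u) (fun _ => Sum.inr v) →
      EqOn s.integrand (glit B 1 p L e ℓ₁ 0 0 1 (fun _ => some 0)) s.domain →
      κ.1 (Fin.last B) = 0 → u - κ = A • (v - u) → 0 < A →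
      (∀ z : Fin (B + 1 + 1) → ℝ, (∀ j, 0 < affF B 1 (M j) z) →
        affF B 1 κ z < 0 ∧ 0 < affF B 1 u z ∧ affF B 1 u z < affF B 1 v z) →
      (∃ z ∈ closure {z : Fin (B + 1 + 1) → ℝ | ∀ j, 0 < affF B 1 (M j) z},
        affF B 1 κ z = 0 ∧ affF B 1 u z = 0 ∧ affF B 1 v z = 0 ∧
        z (Fin.castAdd 1 (Fin.last B)) = affB B 1 (0 : (Fin B → ℚ) × ℚ) z) →
      ∃ c ∈ AddSubgroup.closure (GGset B 2 1), KZ.of s - c ∈ KZ.relations)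
    (Hdfar : ∀ (m' : ℕ) (s : KZ.IntegralRep (B + 1 + 1)) (M : Fin m' → (Fin (B + 1) → ℚ) × ℚ)
      (p : MvPolynomial (Fin B) ℚ) (u v κ : (Fin (B + 1) → ℚ) × ℚ) (A : ℚ), Bornology.IsBounded s.domain →
      s.domain = gDom B 1 m' M (fun _ => Sum.inr u) (fun _ => Sum.inr v) →
      EqOn s.integrand (glit B 1 p L e ℓ₁ 0 0 1 (fun _ => some 0)) s.domain →
      κ.1 (Fin.last B) = 0 → u - κ = A • (v - u) → 0 < A →
      (∀ z : Fin (B + 1 + 1) → ℝ, (∀ j, 0 < affF B 1 (M j) z) →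
        0 < affF B 1 κ z ∧ affF B 1 u z < affF B 1 v z ∧ 2 * affF B 1 κ z ≤ affF B 1 v z) →
      (∃ z ∈ closure {z : Fin (B + 1 + 1) → ℝ | ∀ j, 0 < affF B 1 (M j) z},
        affF B 1 κ z = 0 ∧ affF B 1 u z = 0 ∧ affF B 1 v z = 0 ∧
        z (Fin.castAdd 1 (Fin.last B)) = affB B 1 (0 : (Fin B → ℚ) × ℚ) z) →
      ∃ c ∈ AddSubgroup.closure (GGset B 2 1), KZ.of s - c ∈ KZ.relations) :
    ∃ c ∈ AddSubgroup.closure (GGset B 2 1), KZ.of s - c ∈ KZ.relations := by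
  -- double corners from the key property
  have hdouble : ∀ {m₅ : ℕ} (M₅ : Fin m₅ → (Fin (B + 1) → ℚ) × ℚ) (a' b' : (Fin (B + 1) → ℚ) × ℚ)
      {D : Set (Fin (B + 1 + 1) → ℝ)}, (∀ w ∈ D, |affB B 1 κ₀ w| < |affB B 1 φ₀ w|) →
      gDom B 1 m₅ M₅ (fun _ => Sum.inr a') (fun _ => Sum.inr b') ⊆ D →
      (∀ z : Fin (B + 1 + 1) → ℝ, (∀ j, 0 < affF B 1 (M₅ j) z) → affF B 1 a' z < affF B 1 b' z) →
      (∀ z : Fin (B + 1 + 1) → ℝ, affF B 1 a' z = 0 → affF B 1 b' z = 0 → affF B 1 a z = 0 ∧ affF B 1 b z = 0) →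
      ∀ κ : (Fin (B + 1) → ℚ) × ℚ,
      (∃ z ∈ closure {z : Fin (B + 1 + 1) → ℝ | ∀ j, 0 < affF B 1 (M₅ j) z},
        affF B 1 κ z = 0 ∧ affF B 1 a' z = 0 ∧ affF B 1 b' z = 0) →
      (∃ z ∈ closure {z : Fin (B + 1 + 1) → ℝ | ∀ j, 0 < affF B 1 (M₅ j) z},
        affF B 1 κ z = 0 ∧ affF B 1 a' z = 0 ∧ affF B 1 b' z = 0 ∧
        z (Fin.castAdd 1 (Fin.last B)) = affB B 1 (0 : (Fin B → ℚ) × ℚ) z) := by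
    intro m₅ M₅ a' b' D hZD hsub hab' hback κ ⟨z, hz, hκ, ha', hb'⟩
    obtain ⟨ha0, hb0⟩ := hback z ha' hb'
    refine ⟨z, hz, hκ, ha', hb', ?_⟩
    rw [affB_zeroYT]
    exact hkey z (abs_le_of_closure M₅ a' b' κ₀ φ₀ hZD hsub hab' z hz) ha0 hb0
  -- non-empty fibres
  have hne0 : b - a ≠ 0 := ne_zero_of_last (by
    rw [Prod.fst_sub, Pi.sub_apply]
    exact sub_ne_zero.2 hab.symm)
  obtain ⟨s₂, s₂', hm₂, hm₂', hi₂, -, hd₂, -, hrel₂⟩ := cutBase s M _ _ hdom (b - a) hne0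
  have hsub₂ : s₂.domain ⊆ s.domain := fun z hz => ((hm₂ z).1 hz).1
  refine good_of_split hrel₂ ?_ (good_of_null s₂' ?_)
  swap
  · refine measure_mono_null (fun z hz => ?_) (measure_empty (μ := (volume : Measure (Fin (B + 1 + 1) → ℝ))))
    obtain ⟨hzD, hneg⟩ := (hm₂' z).1 hz
    rw [hdom, mem_gDom_one] at hzD
    rw [affF_sub'] at hneg
    exact absurd (lt_trans hzD.2.1 hzD.2.2) (by linarith)
  have hab₂ : ∀ z : Fin (B + 1 + 1) → ℝ, (∀ j, 0 < affF B 1 ((Fin.snoc M (b - a) : Fin (m' + 1) → _) j) z) →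
      affF B 1 a z < affF B 1 b z := fun z hz => by
    have h := (rows_snoc hz).2
    rw [affF_sub'] at h
    linarith
  have hZ₂ : ∀ w ∈ s₂.domain, |affB B 1 κ₀ w| < |affB B 1 φ₀ w| := fun w hw => hZ w (hsub₂ hw)
  have hint₂ : EqOn s₂.integrand (glit B 1 p L e ℓ₁ 0 0 1 (fun _ => some 0)) s₂.domain := by
    rw [hi₂]; exact hint.mono hsub₂
  -- the sign of `a`
  obtain ⟨s₃, s₄, hm₃, hm₄, hi₃, hi₄, hd₃, hd₄, hrel₃⟩ := cutBase s₂ _ _ _ hd₂ a (ne_zero_of_last ha)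
  have hsub₃ : s₃.domain ⊆ s₂.domain := fun z hz => ((hm₃ z).1 hz).1
  have hsub₄ : s₄.domain ⊆ s₂.domain := fun z hz => ((hm₄ z).1 hz).1
  refine good_of_split hrel₃ ?_ ?_
  · -- above the letter
    have hcell₃ : ∀ z : Fin (B + 1 + 1) → ℝ,
        (∀ j, 0 < affF B 1 ((Fin.snoc (Fin.snoc M (b - a) : Fin (m' + 1) → _) a : Fin (m' + 1 + 1) → _) j) z) →
        0 < affF B 1 a z ∧ affF B 1 a z < affF B 1 b z := fun z hz =>
      ⟨(rows_snoc hz).2, hab₂ z (rows_snoc hz).1⟩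
    have hZ₃ : ∀ w ∈ s₃.domain, |affB B 1 κ₀ w| < |affB B 1 φ₀ w| := fun w hw => hZ₂ w (hsub₃ hw)
    refine good_above_of_corner₂ L e ℓ₁ 0 0 1 s₃ _ p a b (Or.inl rfl) (hbd.subset (hsub₃.trans hsub₂)) hd₃
      (by rw [hi₃]; exact hint₂.mono hsub₃) ha hb hcell₃ Hpar
      (fun m₅ s₅ M₅ κ A hsub₅ hbd₅ hdom₅ hint₅ hκ hA hA0 hcell₅ hc => ?_)
      (fun m₅ s₅ M₅ κ A hsub₅ hbd₅ hdom₅ hint₅ hκ hA hA0 hcell₅ hc => ?_)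
    · exact Hdthick m₅ s₅ M₅ p a b κ A hbd₅ hdom₅ hint₅ hκ hA hA0 hcell₅
        (hdouble M₅ a b hZ₃ (hdom₅ ▸ hsub₅) (fun z hz => (hcell₅ z hz).2.2) (fun z h1 h2 => ⟨h1, h2⟩) κ hc)
    · exact Hdfar m₅ s₅ M₅ p a b κ A hbd₅ hdom₅ hint₅ hκ hA hA0 hcell₅
        (hdouble M₅ a b hZ₃ (hdom₅ ▸ hsub₅) (fun z hz => (hcell₅ z hz).2.1) (fun z h1 h2 => ⟨h1, h2⟩) κ hc)
  -- the sign of `b`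
  obtain ⟨s₅, s₆, hm₅, hm₆, hi₅, hi₆, hd₅, hd₆, hrel₅⟩ :=
    cutBase s₄ (Fin.snoc (Fin.snoc M (b - a) : Fin (m' + 1) → _) (-a)) _ _ hd₄ b (ne_zero_of_last hb)
  have hsub₅ : s₅.domain ⊆ s₂.domain := fun z hz => hsub₄ ((hm₅ z).1 hz).1
  have hsub₆ : s₆.domain ⊆ s₂.domain := fun z hz => hsub₄ ((hm₆ z).1 hz).1
  refine good_of_split hrel₅ ?_ ?_
  · -- crossing the letter: split at the level `0`
    refine good_levelSplit (fun _ => some 0) (fun _ => a) (fun _ => b) s₅ _ L e p ℓ₁ 0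
      (fun _ => Sum.inr a) (fun _ => Sum.inr b) (Or.inl rfl) (hbd.subset (hsub₅.trans hsub₂)) hd₅
      (by rw [hi₅, hi₄]; exact hint₂.mono hsub₅) (fun _ => rfl) (fun _ => rfl) 0 0
      (fun i c hi _ => absurd (Subsingleton.elim i 0) hi) (fun c hc => by cases hc; rfl)
      fun z hz => ?_
    obtain ⟨hz', hbz⟩ := rows_snoc hz
    obtain ⟨-, haz⟩ := rows_snoc hz'
    rw [affF_neg'] at haz
    rw [affF_zero']
    exact ⟨by linarith, hbz.le⟩
  · -- below the letter: reflect `T ↦ -T`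
    have hcell₆ : ∀ z : Fin (B + 1 + 1) → ℝ,
        (∀ j, 0 < affF B 1 ((Fin.snoc (Fin.snoc (Fin.snoc M (b - a) : Fin (m' + 1) → _) (-a) :
          Fin (m' + 1 + 1) → _) (-b) : Fin (m' + 1 + 1 + 1) → _) j) z) →
        affF B 1 a z < affF B 1 b z ∧ affF B 1 b z < 0 := fun z hz => by
      obtain ⟨hz', hbz⟩ := rows_snoc hz
      obtain ⟨hz'', -⟩ := rows_snoc hz'
      rw [affF_neg'] at hbz
      exact ⟨hab₂ z hz'', by linarith⟩
    have hZ₆ : ∀ w ∈ s₆.domain, |affB B 1 κ₀ w| < |affB B 1 φ₀ w| := fun w hw => hZ₂ w (hsub₆ hw)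
    have hint₆ : EqOn s₆.integrand (glit B 1 p L e ℓ₁ 0 0 1 (fun _ => some 0)) s₆.domain := by
      rw [hi₆, hi₄]; exact hint₂.mono hsub₆
    obtain ⟨s₇, hΨ₇, hbd₇, hdom₇, hint₇, hrel₇⟩ := pull (fun _ : Fin 1 => (-1 : ℚ)) (fun _ => (0 : ℚ))
      (fun _ => (0 : (Fin B → ℚ) × ℚ)) s₆ _ L e p ℓ₁ 0 0 1 (fun _ => some 0) (fun _ => Sum.inr a)
      (fun _ => Sum.inr b) (hbd.subset (hsub₆.trans hsub₂)) hd₆ hint₆ (fun _ => by norm_num)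
      (fun i j hij => by rcases hij with h | h <;> cases h)
    suffices hs₇ : ∃ c ∈ AddSubgroup.closure (GGset B 2 1), KZ.of s₇ - c ∈ KZ.relations by
      obtain ⟨c₀, hc₀, hc₀'⟩ := hs₇
      exact ⟨c₀, hc₀, by have := add_mem hrel₇ hc₀'; rwa [sub_add_sub_cancel] at this⟩
    have hZ₇ : ∀ w ∈ s₇.domain, |affB B 1 κ₀ w| < |affB B 1 φ₀ w| := fun w hw => by
      have h := hZ₆ _ ((hΨ₇ w).1 hw)
      rwa [affB_pullInv, affB_pullInv] at h
    have hneg1 : ¬ ((0 : ℚ) < -1) := by norm_num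
    have hd₇ : s₇.domain = gDom B 1 _ (Fin.snoc (Fin.snoc (Fin.snoc M (b - a) : Fin (m' + 1) → _) (-a) :
        Fin (m' + 1 + 1) → _) (-b)) (fun _ => Sum.inr (-b)) (fun _ => Sum.inr (-a)) := by
      rw [hdom₇]
      congr 1 <;> funext i <;> simp [pullLo, pullHi, hneg1, pullC_reflect]
    have hi₇ : EqOn s₇.integrand (glit B 1 (MvPolynomial.C (pullQ (fun _ : Fin 1 => (-1 : ℚ))
        (fun _ => some (0 : (Fin (B + 1) → ℚ) × ℚ))) * p) L e ℓ₁ 0 0 1 (fun _ => some 0)) s₇.domain := by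
      convert hint₇ using 2
      funext i
      simp [pullA, pullC_reflect]
    have hcell₇ : ∀ z : Fin (B + 1 + 1) → ℝ,
        (∀ j, 0 < affF B 1 ((Fin.snoc (Fin.snoc (Fin.snoc M (b - a) : Fin (m' + 1) → _) (-a) :
          Fin (m' + 1 + 1) → _) (-b) : Fin (m' + 1 + 1 + 1) → _) j) z) →
        0 < affF B 1 (-b) z ∧ affF B 1 (-b) z < affF B 1 (-a) z := fun z hz => by
      obtain ⟨h1, h2⟩ := hcell₆ z hz
      rw [affF_neg', affF_neg']
      exact ⟨by linarith, by linarith⟩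
    have hback : ∀ z : Fin (B + 1 + 1) → ℝ, affF B 1 (-b) z = 0 → affF B 1 (-a) z = 0 →
        affF B 1 a z = 0 ∧ affF B 1 b z = 0 := fun z h1 h2 => by
      rw [affF_neg', neg_eq_zero] at h1 h2
      exact ⟨h2, h1⟩
    refine good_above_of_corner₂ L e ℓ₁ 0 0 1 s₇ _ _ (-b) (-a) (Or.inl rfl) hbd₇ hd₇ hi₇
      (by simpa using hb) (by simpa using ha) hcell₇ Hpar
      (fun m₅ s₅ M₅ κ A hsub₅ hbd₅ hdom₅ hint₅ hκ hA hA0 hcell₅ hc => ?_)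
      (fun m₅ s₅ M₅ κ A hsub₅ hbd₅ hdom₅ hint₅ hκ hA hA0 hcell₅ hc => ?_)
    · exact Hdthick m₅ s₅ M₅ _ (-b) (-a) κ A hbd₅ hdom₅ hint₅ hκ hA hA0 hcell₅
        (hdouble M₅ (-b) (-a) hZ₇ (hdom₅ ▸ hsub₅) (fun z hz => (hcell₅ z hz).2.2) hback κ hc)
    · exact Hdfar m₅ s₅ M₅ _ (-b) (-a) κ A hbd₅ hdom₅ hint₅ hκ hA hA0 hcell₅
        (hdouble M₅ (-b) (-a) hZ₇ (hdom₅ ▸ hsub₅) (fun z hz => (hcell₅ z hz).2.1) hback κ hc)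

end SwapSheared

end RebasePos

/-- **Registered part of `stub_rebaseSimplePosOne` (line `janus-bands`, v6.2): the region
invariant on the closed base cell** (`RebasePos.abs_le_of_closure`): if two `x'`-forms satisfy
`|κ₀| < |φ₀|` on a set containing a band with non-empty fibres over its base cell, then
`|κ₀| ≤ |φ₀|` on the closure of the open base cell (the input of the double-corner test of
`RebasePos.good_shearedPiece`, the main result of this file). -/
theorem rebaseSimplePos_absLeOfClosure (B m' : ℕ) (M : Fin m' → (Fin (B + 1) → ℚ) × ℚ) (a b : (Fin (B + 1) → ℚ) × ℚ) (κ₀ φ₀ : (Fin B → ℚ) × ℚ) (D : Set (Fin (B + 1 + 1) → ℝ)) (hZ : ∀ w ∈ D, |SeparatePos.affB B 1 κ₀ w| < |SeparatePos.affB B 1 φ₀ w|) (hsub : SeparatePos.gDom B 1 m' M (fun _ => Sum.inr a) (fun _ => Sum.inr b) ⊆ D) (hab : ∀ z : Fin (B + 1 + 1) → ℝ, (∀ j, 0 < SeparatePos.affF B 1 (M j) z) → SeparatePos.affF B 1 a z < SeparatePos.affF B 1 b z) : ∀ z ∈ closure {z : Fin (B + 1 + 1) → ℝ | ∀ j, 0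 < SeparatePos.affF B 1 (M j) z}, |SeparatePos.affB B 1 κ₀ z| ≤ |SeparatePos.affB B 1 φ₀ z| :=
  RebasePos.abs_le_of_closure M a b κ₀ φ₀ hZ hsub hab

end Summit.KontsevichZagierPeriods.ArrangementNormalForm.JanusBands
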